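import Summits.KontsevichZagierPeriods.KontsevichZagierPeriods.Theorems.KzOnePeriodsGmWinding
import Summits.KontsevichZagierPeriods.KontsevichZagierPeriods.Theorems.KzOnePeriodsG2SUnit

/-!
# KZ 1-periods (kz1p): the Pell unit over kz1p's lifted ovals — winding numbers `1` and `0`

Helper file of the `kz1p` support package (explicit unit `b2b-kz1p`, helper lane; it supports the audited
statement item of `KzOnePeriods` without closing it).  Shape (U) "unit at infinity", part 3/3.
`KzOnePeriodsG2SUnit.lean` transports the third-kind period `∫_γ θ_p`, `θ_p ∼ p dx/(2y) ≡ du/u`, of the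
genus-2 plane model `C_{a,b,c} : y² = x⁶ + a x⁴ + b x² + c` to the logarithm symbol `(𝔾ₘ, v du, (u, ū)∘γ)` of a
Pell unit `u = P + Q y` (`P² − Q² f = 1`); `KzOnePeriodsGmWinding.lean` evaluates such a symbol over a closed
loop from a sign pattern of `u`.  Here the two are joined ON kz1p's cycles: the lifts `γ = (x, y)`,
`x = ±√(c/(X − b/3))`, `y = ηY·x³/c` (`exists_liftPath2`) of the ovals `δ = (X, ηY)` of the second quotient
`E₂′` over a 2-torsion interval `[p, q]` (`exists_weierOval`: `Y = ε (p−q)/2 · sin 2πt · √(−σ(X − r))`).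
For a unit with `P = P_e(x²)` even and `Q = x·Q_o(x²)` odd and real (rational) coefficients — the shape of
the units of the even sextics in kz1p's corpus — one has along the lift, with `ρ = c/(X − b/3) = x² > 0`,
`u(γ(t)) = P_e(ρ) + η · Y Q_o(ρ) ρ²/c` (`pell_lift_coord`).  Hence:

* `pell_imagOval` (imaginary oval, `η = i`): `u(γ(0)) = P_e(ρ(p))`, `u(γ(½)) = P_e(ρ(q))`, and
  `Im u(γ(t)) = Y·Q_o(ρ)ρ²/c` has the sign of `±sin 2πt`; so if `P_e(ρ(p)) > 0 > P_e(ρ(q))` and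
  `ε (p−q)/2 · Q_o(ρ)/c > 0` on the oval (three rational sign checks in the generated files), the loop
  `u∘γ` has WINDING NUMBER ONE: `(C, θ_p, γ) ∼ (𝔾ₘ, v du, Λ_{1,1})` and `∫_γ θ_p = 2πi`;
* `pell_realOval` (real oval, `η = 1`): `u∘γ` is real, never `0` (`u ū = 1`) and positive at `t = 0`, hence
  positive (intermediate value theorem): `(C, θ_p, γ) ∈ ⟨(R1)–(R5)⟩_ℚ̄` and `∫_γ θ_p = 0`.

These are the inputs of the generated derivations of kz1p's `relation` verdicts whose query contains the
third-kind period `∫ x² dx/(2y)` (residue divisor at `∞±`) over a lifted oval, e.g. `G2-12`, `G2-13` on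
`y² = (x² − 1)(x² − 2)(x² − 3)` with the unit `u = −(x⁴ − 3x² + 1) − x·y`.

[cite: HuberWustholz2022, §3.3.1 (pp. 42–43), §10.1 (p. 96), §13.1 (p. 120), Thm 13.3 (2) (p. 121)]

No new axioms; no statements of the programme are cited.
-/

noncomputable section

open scoped BigOperators
open MvPolynomial Set Complex Filter Topology
open Literature.NumberTheory.Transcendental Literature.NumberTheory.Transcendental.CurvePeriods
open Summit.KontsevichZagierPeriods.KzOnePeriods.E1Derivation
open Summit.KontsevichZagierPeriods.KzOnePeriods.XiDerivation

namespace Summit.KontsevichZagierPeriods.KzOnePeriods.G2SDerivation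

local notation3 "InSpanRel " c:arg => ∃ (k : ℕ) (ρ : Fin k → (PeriodSymbol →₀ ℂ))
  (a : Fin k → ℂ), (∀ l, IsElementaryRelation (ρ l)) ∧ (∀ l, IsAlgebraic ℚ (a l)) ∧
    c = ∑ l, a l • ρ l

/-- The symbol `(Z, ω, γ)` as an element of the formal period space. -/
local notation3 (prettyPrint := false) "Sy[" Z ", " hZ ", " ω ", " h ", " γ "]" =>
  (Finsupp.single (⟨Z, hZ, ω, h, γ⟩ : PeriodSymbol) (1 : ℂ) : PeriodSymbol →₀ ℂ)

/-- The period `∫_γ ω` of the symbol `(Z, ω, γ)`. -/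
local notation3 (prettyPrint := false) "Pe[" Z ", " hZ ", " ω ", " h ", " γ "]" =>
  PeriodSymbol.period (⟨Z, hZ, ω, h, γ⟩ : PeriodSymbol)

/-- The even sextic `f = x⁶ + a x⁴ + b x² + c ∈ ℂ[x, y]`. -/
local notation3 (prettyPrint := false) "fS[" a ", " b ", " c "]" =>
  ((X 0 : MvPolynomial (Fin 2) ℂ) ^ 6 + C a * X 0 ^ 4 + C b * X 0 ^ 2 + C c)

/-- The affine plane model `C_{a,b,c} = {y² = f(x)} ⊂ 𝔸²` of the genus-2 curve (minus `∞±`). -/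
local notation3 (prettyPrint := false) "Cpl[" a ", " b ", " c "]" =>
  (⟨2, 1, ![(X 1 : MvPolynomial (Fin 2) ℂ) ^ 2 - fS[a, b, c]]⟩ : CurveData)

/-- The polynomial `Σ_k π_k x^k ∈ ℂ[x, y]` with coefficient vector `π`. -/
local notation3 (prettyPrint := false) "Pol[" π "]" =>
  (∑ k, C (π k) * (X 0 : MvPolynomial (Fin 2) ℂ) ^ (k : ℕ))

/-- The even polynomial `U = Σ_{k<3} μ_k x^{2k}` (Bézout cofactor of `f`). -/
local notation3 (prettyPrint := false) "Upol[" μ "]" =>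
  (∑ k : Fin 3, C (μ k) * (X 0 : MvPolynomial (Fin 2) ℂ) ^ (2 * (k : ℕ)))

/-- The odd polynomial `V = Σ_{k<3} ν_k x^{2k+1}` (Bézout cofactor of `f′`). -/
local notation3 (prettyPrint := false) "Vpol[" ν "]" =>
  (∑ k : Fin 3, C (ν k) * (X 0 : MvPolynomial (Fin 2) ℂ) ^ (2 * (k : ℕ) + 1))

/-- `θ[μ, ν, π] = (½ P U y) dx + (P V) dy`, the polynomial representative of `P(x) dx/(2y)`. -/
local notation3 (prettyPrint := false) "θ[" μ ", " ν ", " π "]" =>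
  (![C (1 / 2 : ℂ) * Pol[π] * Upol[μ] * X 1, Pol[π] * Vpol[ν]] :
    Fin 2 → MvPolynomial (Fin 2) ℂ)

/-- The Bézout identity `U f + V f′ = 1` (scalar form). -/
local notation3 (prettyPrint := false) "Bez[" a ", " b ", " c ", " μ ", " ν "]" =>
  (∀ x : ℂ, (∑ k : Fin 3, μ k * x ^ (2 * (k : ℕ))) * (x ^ 6 + a * x ^ 4 + b * x ^ 2 + c) +
    (∑ k : Fin 3, ν k * x ^ (2 * (k : ℕ) + 1)) * (6 * x ^ 5 + 4 * a * x ^ 3 + 2 * b * x) = 1)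

/-- The multiplicative group `𝔾ₘ = {uv = 1} ⊂ 𝔸²`. -/
local notation3 (prettyPrint := false) "𝔾m" => (⟨2, 1, ![X 0 * X 1 - 1]⟩ : CurveData)

/-- The logarithm symbol `(𝔾ₘ, v du, E)` over a path `E` on `𝔾ₘ`. -/
local notation3 "logSym " E:arg => (⟨⟨2, 1, ![X 0 * X 1 - 1]⟩, isSmoothAffineCurve_mulGroup,
  ![X 1, 0], hasAlgCoeffs_ydx, E⟩ : PeriodSymbol)

/-- **The Pell unit map** `(u, ū) = (P + Q y, P − Q y) : C_{a,b,c} → 𝔸²`, `P = Pol[e]`, `Q = Pol[d]`. -/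
local notation3 (prettyPrint := false) "pell[" e ", " d "]" =>
  (![Pol[e] + Pol[d] * X 1, Pol[e] - Pol[d] * X 1] : Fin 2 → MvPolynomial (Fin 2) ℂ)

/-- The Pell equation `P² − Q² f = 1` (scalar form): `u ū = 1`. -/
local notation3 (prettyPrint := false) "Pell[" a ", " b ", " c ", " e ", " d "]" =>
  (∀ x : ℂ, (∑ k, e k * x ^ (k : ℕ)) ^ 2 -
    (∑ k, d k * x ^ (k : ℕ)) ^ 2 * (x ^ 6 + a * x ^ 4 + b * x ^ 2 + c) = 1)

/-- Its derivative `2 P P′ − 2 Q Q′ f − Q² f′ = 0` (scalar form). -/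
local notation3 (prettyPrint := false) "PellD[" a ", " b ", " c ", " e ", " d "]" =>
  (∀ x : ℂ, 2 * (∑ k, e k * x ^ (k : ℕ)) * (∑ k, e k * ((k : ℕ) : ℂ) * x ^ ((k : ℕ) - 1)) -
    2 * (∑ k, d k * x ^ (k : ℕ)) * (∑ k, d k * ((k : ℕ) : ℂ) * x ^ ((k : ℕ) - 1)) *
      (x ^ 6 + a * x ^ 4 + b * x ^ 2 + c) -
    (∑ k, d k * x ^ (k : ℕ)) ^ 2 * (6 * x ^ 5 + 4 * a * x ^ 3 + 2 * b * x) = 0)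

/-- `p = 2(P Q′ − P′ Q) f + P Q f′` (scalar form): `du/u ≡ p dx/(2y)` on `C`. -/
local notation3 (prettyPrint := false) "LogD[" a ", " b ", " c ", " e ", " d ", " π "]" =>
  (∀ x : ℂ, ∑ k, π k * x ^ (k : ℕ) =
    2 * ((∑ k, e k * x ^ (k : ℕ)) * (∑ k, d k * ((k : ℕ) : ℂ) * x ^ ((k : ℕ) - 1)) -
      (∑ k, e k * ((k : ℕ) : ℂ) * x ^ ((k : ℕ) - 1)) * (∑ k, d k * x ^ (k : ℕ))) *
      (x ^ 6 + a * x ^ 4 + b * x ^ 2 + c) +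
    (∑ k, e k * x ^ (k : ℕ)) * (∑ k, d k * x ^ (k : ℕ)) * (6 * x ^ 5 + 4 * a * x ^ 3 + 2 * b * x))

variable {a b c : ℂ}

/-! ### The unit along a lifted oval -/

/-- **The unit along the lift.**  For `P = P_e(x²)`, `Q = x Q_o(x²)` (real coefficient vectors `pe`, `qo`)
and a point `z = (x, η Y x³/c)` with `x = ±√ρ`, `ρ ≥ 0`, `c` real:
`u(z) = P(x) + Q(x)·z₁ = P_e(ρ) + η · (Y Q_o(ρ) ρ² / c)`. -/
theorem pell_lift_coord {N M N' M' : ℕ} {e : Fin N → ℂ} {d : Fin M → ℂ} {pe : Fin N' → ℚ}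
    {qo : Fin M' → ℚ}
    (hPe : ∀ x : ℂ, ∑ k, e k * x ^ (k : ℕ) = ∑ j, ((pe j : ℚ) : ℂ) * (x ^ 2) ^ (j : ℕ))
    (hQo : ∀ x : ℂ, ∑ k, d k * x ^ (k : ℕ) = x * ∑ j, ((qo j : ℚ) : ℂ) * (x ^ 2) ^ (j : ℕ))
    {cr ρ Yt xs : ℝ} (hcr : c = (cr : ℂ)) (hxs : xs = 1 ∨ xs = -1) (hρ : 0 ≤ ρ) (η : ℂ)
    {z : Fin 2 → ℂ}
    (hz : z = ![((xs * √ρ : ℝ) : ℂ), η * (Yt : ℂ) * ((xs * √ρ : ℝ) : ℂ) ^ 3 / c]) :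
    (∑ k, e k * z 0 ^ (k : ℕ)) + (∑ k, d k * z 0 ^ (k : ℕ)) * z 1 =
      ((∑ j, (pe j : ℝ) * ρ ^ (j : ℕ) : ℝ) : ℂ) +
        η * ((Yt * (∑ j, (qo j : ℝ) * ρ ^ (j : ℕ)) * ρ ^ 2 / cr : ℝ) : ℂ) := by
  have hxs2 : xs ^ 2 = 1 := by rcases hxs with rfl | rfl <;> norm_num
  have hx2 : ((xs * √ρ : ℝ) : ℂ) ^ 2 = (ρ : ℂ) := by
    rw [← ofReal_pow, mul_pow, hxs2, one_mul, Real.sq_sqrt hρ]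
  have hx4 : ((xs * √ρ : ℝ) : ℂ) * ((xs * √ρ : ℝ) : ℂ) ^ 3 = (ρ : ℂ) ^ 2 := by
    rw [← hx2]; ring
  subst hz
  simp only [Matrix.cons_val_zero, Matrix.cons_val_one]
  generalize ((xs * √ρ : ℝ) : ℂ) = w at hx2 hx4 ⊢
  rw [hPe, hQo, hx2, hcr]
  push_cast
  linear_combination (η * (Yt : ℂ) * (∑ j, ((qo j : ℚ) : ℂ) * (ρ : ℂ) ^ (j : ℕ)) / (cr : ℂ)) * hx4

/-- `sin 2πt > 0` for `0 < t < ½`. -/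
theorem sin_two_pi_mul_pos {t : ℝ} (ht : t ∈ Ioo (0 : ℝ) (1 / 2)) :
    0 < Real.sin (2 * Real.pi * t) :=
  Real.sin_pos_of_pos_of_lt_pi (by nlinarith [Real.pi_pos, ht.1]) (by nlinarith [Real.pi_pos, ht.2])

/-- `sin 2πt < 0` for `½ < t < 1`. -/
theorem sin_two_pi_mul_neg {t : ℝ} (ht : t ∈ Ioo (1 / 2 : ℝ) 1) :
    Real.sin (2 * Real.pi * t) < 0 := by
  rw [← Real.sin_sub_two_pi]
  exact Real.sin_neg_of_neg_of_neg_pi_lt (by nlinarith [Real.pi_pos, ht.2])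
    (by nlinarith [Real.pi_pos, ht.1])

/-- Sign bookkeeping: `κ s w S ρ²/c > 0` from `κ S/c > 0`, `s, w, ρ > 0`. -/
theorem sign_aux_pos {κ s w S ρ cr : ℝ} (hq : 0 < κ * S / cr) (hs : 0 < s) (hw : 0 < w)
    (hρ : 0 < ρ) : 0 < κ * s * w * S * ρ ^ 2 / cr := by
  have : κ * s * w * S * ρ ^ 2 / cr = (κ * S / cr) * (s * w * ρ ^ 2) := by ring
  rw [this]
  exact mul_pos hq (mul_pos (mul_pos hs hw) (pow_pos hρ 2))

/-- Sign bookkeeping: `κ s w S ρ²/c < 0` from `κ S/c > 0`, `s < 0`, `w, ρ > 0`. -/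
theorem sign_aux_neg {κ s w S ρ cr : ℝ} (hq : 0 < κ * S / cr) (hs : s < 0) (hw : 0 < w)
    (hρ : 0 < ρ) : κ * s * w * S * ρ ^ 2 / cr < 0 := by
  have : κ * s * w * S * ρ ^ 2 / cr = -((κ * S / cr) * (-s * w * ρ ^ 2)) := by ring
  rw [this]
  exact neg_neg_of_pos (mul_pos hq (mul_pos (mul_pos (neg_pos.2 hs) hw) (pow_pos hρ 2)))

/-! ### Winding number one: the unit over a lifted imaginary oval -/

/-- **`∫_γ θ_p = 2πi` over a lifted imaginary oval.**  Data: the curve `C_{a,b,c}` with a Bézout pair, a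
Pell unit `u = P + Q y` (`Pell`, `PellD`) with `p`'s defining identity `LogD`, `P = P_e(x²)`, `Q = x Q_o(x²)`
(`pe`, `qo` rational); the oval data `Y = ε (p−q)/2 · sin 2πt · √(−σ(X − r))` with positive radicand on
`[0, 1]`, `X(0) = X(1) = p`, `X(½) = q`, `Y(0) = Y(½) = Y(1) = 0` (as produced by `exists_weierOval`), and the
lift `γ = (±√ρ, i·Y·x³/c)`, `ρ = c/(X − b/3) > 0` (as produced by `exists_liftPath2` with `η = i`).  If
`P_e(ρ(p)) > 0`, `P_e(ρ(q)) < 0` and `ε (p−q)/2 · Q_o(ρ)/c > 0` on `[0, 1]`, then `u∘γ` starts at the positive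
real `P_e(ρ(p))`, passes the negative real `P_e(ρ(q))` at `t = ½`, with `Im u > 0` before and `Im u < 0` after:
winding number one (`span_logSym_halves`), so `(C, θ_p, γ) − (𝔾ₘ, v du, Λ_{1,1}) ∈ ⟨(R1)–(R5)⟩_ℚ̄` for the
standard unit loop `Λ_{1,1}` and `∫_γ θ_p = 2πi`.
[cite: HuberWustholz2022, §3.3.1 (pp. 42–43), §10.1 (p. 96), Thm 13.3 (2) (p. 121)] -/
theorem pell_imagOval (ha : IsAlgebraic ℚ a) (hb : IsAlgebraic ℚ b) (hc : IsAlgebraic ℚ c)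
    {μ ν : Fin 3 → ℂ} (hμ : ∀ k, IsAlgebraic ℚ (μ k)) (hν : ∀ k, IsAlgebraic ℚ (ν k))
    (hbez : Bez[a, b, c, μ, ν]) {N M L : ℕ} {e : Fin N → ℂ} {d : Fin M → ℂ} {π : Fin L → ℂ}
    (he : ∀ k, IsAlgebraic ℚ (e k)) (hd : ∀ k, IsAlgebraic ℚ (d k)) (hπ : ∀ k, IsAlgebraic ℚ (π k))
    (hunit : Pell[a, b, c, e, d]) (hunitD : PellD[a, b, c, e, d]) (hp : LogD[a, b, c, e, d, π])
    {N' M' : ℕ} {pe : Fin N' → ℚ} {qo : Fin M' → ℚ}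
    (hPe : ∀ x : ℂ, ∑ k, e k * x ^ (k : ℕ) = ∑ j, ((pe j : ℚ) : ℂ) * (x ^ 2) ^ (j : ℕ))
    (hQo : ∀ x : ℂ, ∑ k, d k * x ^ (k : ℕ) = x * ∑ j, ((qo j : ℚ) : ℂ) * (x ^ 2) ^ (j : ℕ))
    {br cr : ℝ} (hcr : c = (cr : ℂ)) {X Y : ℝ → ℝ} {p q r σ ε xs : ℝ} (hxs : xs = 1 ∨ xs = -1)
    (hY : ∀ t, Y t = ε * ((p - q) / 2) * Real.sin (2 * Real.pi * t) * √(-σ * (X t - r)))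
    (hL : ∀ t ∈ Icc (0 : ℝ) 1, 0 < -σ * (X t - r))
    (h0 : X 0 = p ∧ Y 0 = 0) (h1 : X 1 = p ∧ Y 1 = 0) (hh : X (1 / 2) = q ∧ Y (1 / 2) = 0)
    {γ : CurvePath Cpl[a, b, c]}
    (hγ : ∀ t, γ.toFun t = ![((xs * √(cr / (X t - br / 3)) : ℝ) : ℂ),
      I * (Y t : ℂ) * ((xs * √(cr / (X t - br / 3)) : ℝ) : ℂ) ^ 3 / c])
    (hpos : ∀ t ∈ Icc (0 : ℝ) 1, 0 < cr / (X t - br / 3))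
    (hP0 : 0 < ∑ j, (pe j : ℝ) * (cr / (p - br / 3)) ^ (j : ℕ))
    (hPh : ∑ j, (pe j : ℝ) * (cr / (q - br / 3)) ^ (j : ℕ) < 0)
    (hQ : ∀ t ∈ Icc (0 : ℝ) 1,
      0 < ε * ((p - q) / 2) * (∑ j, (qo j : ℝ) * (cr / (X t - br / 3)) ^ (j : ℕ)) / cr) :
    (∃ Λ₁ : CurvePath 𝔾m, (∀ t, Λ₁.toFun t =
        ![1 * exp (((1 : ℤ) : ℂ) * (2 * Real.pi * I) * t),
          1⁻¹ * exp (-(((1 : ℤ) : ℂ) * (2 * Real.pi * I) * t))]) ∧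
      InSpanRel (Sy[Cpl[a, b, c], smooth ha hb hc hbez, θ[μ, ν, π], hasAlgCoeffs_theta hμ hν hπ, γ] -
        Finsupp.single (logSym Λ₁) (1 : ℂ))) ∧
    Pe[Cpl[a, b, c], smooth ha hb hc hbez, θ[μ, ν, π], hasAlgCoeffs_theta hμ hν hπ, γ] =
      2 * Real.pi * I := by
  have hI0 : (0 : ℝ) ∈ Icc (0 : ℝ) 1 := ⟨le_rfl, zero_le_one⟩
  have hI1 : (1 : ℝ) ∈ Icc (0 : ℝ) 1 := ⟨zero_le_one, le_rfl⟩
  have hIh : (1 / 2 : ℝ) ∈ Icc (0 : ℝ) 1 := ⟨by norm_num, by norm_num⟩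
  obtain ⟨γ', hγ'⟩ := exists_pellPath he hd hunit γ
  -- the unit along the lift, explicitly
  have hco : ∀ t ∈ Icc (0 : ℝ) 1, γ'.toFun t 0 =
      ((∑ j, (pe j : ℝ) * (cr / (X t - br / 3)) ^ (j : ℕ) : ℝ) : ℂ) +
        I * ((Y t * (∑ j, (qo j : ℝ) * (cr / (X t - br / 3)) ^ (j : ℕ)) *
          (cr / (X t - br / 3)) ^ 2 / cr : ℝ) : ℂ) := fun t ht => by
    rw [hγ', Matrix.cons_val_zero]
    exact pell_lift_coord hPe hQo hcr hxs (hpos t ht).le I (hγ t)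
  have him : ∀ t ∈ Icc (0 : ℝ) 1, (γ'.toFun t 0).im =
      Y t * (∑ j, (qo j : ℝ) * (cr / (X t - br / 3)) ^ (j : ℕ)) *
        (cr / (X t - br / 3)) ^ 2 / cr := fun t ht => by
    rw [hco t ht]
    simp only [add_im, mul_im, I_re, I_im, ofReal_re, ofReal_im, zero_mul, one_mul, zero_add]
  have hv0 : γ'.toFun 0 0 = ((∑ j, (pe j : ℝ) * (cr / (p - br / 3)) ^ (j : ℕ) : ℝ) : ℂ) := by
    rw [hco 0 hI0, h0.1, h0.2]
    simp
  have hvh : γ'.toFun (1 / 2) 0 =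
      -((-(∑ j, (pe j : ℝ) * (cr / (q - br / 3)) ^ (j : ℕ)) : ℝ) : ℂ) := by
    rw [hco (1 / 2) hIh, hh.1, hh.2]
    simp
  have hv1 : γ'.toFun 1 0 = γ'.toFun 0 0 := by
    rw [hco 1 hI1, hco 0 hI0, h1.1, h1.2, h0.1, h0.2]
  have hup : ∀ t ∈ Ioo (0 : ℝ) (1 / 2), 0 < (γ'.toFun t 0).im := fun t ht => by
    have htI : t ∈ Icc (0 : ℝ) 1 := ⟨ht.1.le, by linarith [ht.2]⟩
    rw [him t htI, hY t]
    exact sign_aux_pos (hQ t htI) (sin_two_pi_mul_pos ht) (Real.sqrt_pos.2 (hL t htI)) (hpos t htI)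
  have hdn : ∀ t ∈ Ioo (1 / 2 : ℝ) 1, (γ'.toFun t 0).im < 0 := fun t ht => by
    have htI : t ∈ Icc (0 : ℝ) 1 := ⟨by linarith [ht.1], ht.2.le⟩
    rw [him t htI, hY t]
    exact sign_aux_neg (hQ t htI) (sin_two_pi_mul_neg ht) (Real.sqrt_pos.2 (hL t htI)) (hpos t htI)
  obtain ⟨Λ₁, hΛ₁⟩ := exists_stdLoop (isAlgebraic_one (R := ℚ) (A := ℂ)) one_ne_zero 1
  have hsp := span_logSym_halves γ' hP0 (neg_pos.2 hPh) hv0 hvh hv1 hup hdn Λ₁ hΛ₁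
  have hpe := period_logSym_halves γ' hP0 (neg_pos.2 hPh) hv0 hvh hv1 hup hdn Λ₁ hΛ₁
  refine ⟨⟨Λ₁, hΛ₁, ?_⟩, ?_⟩
  · obtain ⟨k, R, w, hR, hw, hsum⟩ := span_add
      (span_pell ha hb hc hμ hν hbez he hd hπ hunit hunitD hp (fun t _ => hγ' t)) hsp
    exact ⟨k, R, w, hR, hw, by rw [← hsum, sub_add_sub_cancel]⟩
  · rw [relation_pell ha hb hc hμ hν hbez he hd hπ hunit hunitD hp (fun t _ => hγ' t), hpe]

/-! ### Winding number zero: the unit over a lifted real oval -/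

/-- **`∫_γ θ_p = 0` over a lifted real oval.**  Same unit data; the lift `γ = (±√ρ, Y·x³/c)` of a REAL oval
(`η = 1`) with `X(0) = X(1) = p`, `Y(0) = Y(1) = 0`.  Then `u∘γ = P_e(ρ) + Y Q_o(ρ)ρ²/c` is real, never zero
(`u ū = 1` on `𝔾ₘ`), equal at `t = 0, 1`, and positive at `t = 0` if `P_e(ρ(p)) > 0`, hence positive on `[0, 1]`
(intermediate value theorem): `(C, θ_p, γ) ∼ (𝔾ₘ, v du, u∘γ) ∼ ℓ(log 1) ∼ 0` (`span_logSym_realPos_closed`) and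
`∫_γ θ_p = 0`. [cite: HuberWustholz2022, §3.3.1 (pp. 42–43), Thm 13.3 (2) (p. 121)] -/
theorem pell_realOval (ha : IsAlgebraic ℚ a) (hb : IsAlgebraic ℚ b) (hc : IsAlgebraic ℚ c)
    {μ ν : Fin 3 → ℂ} (hμ : ∀ k, IsAlgebraic ℚ (μ k)) (hν : ∀ k, IsAlgebraic ℚ (ν k))
    (hbez : Bez[a, b, c, μ, ν]) {N M L : ℕ} {e : Fin N → ℂ} {d : Fin M → ℂ} {π : Fin L → ℂ}
    (he : ∀ k, IsAlgebraic ℚ (e k)) (hd : ∀ k, IsAlgebraic ℚ (d k)) (hπ : ∀ k, IsAlgebraic ℚ (π k))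
    (hunit : Pell[a, b, c, e, d]) (hunitD : PellD[a, b, c, e, d]) (hp : LogD[a, b, c, e, d, π])
    {N' M' : ℕ} {pe : Fin N' → ℚ} {qo : Fin M' → ℚ}
    (hPe : ∀ x : ℂ, ∑ k, e k * x ^ (k : ℕ) = ∑ j, ((pe j : ℚ) : ℂ) * (x ^ 2) ^ (j : ℕ))
    (hQo : ∀ x : ℂ, ∑ k, d k * x ^ (k : ℕ) = x * ∑ j, ((qo j : ℚ) : ℂ) * (x ^ 2) ^ (j : ℕ))
    {br cr : ℝ} (hcr : c = (cr : ℂ)) {X Y : ℝ → ℝ} {p xs : ℝ} (hxs : xs = 1 ∨ xs = -1)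
    (h0 : X 0 = p ∧ Y 0 = 0) (h1 : X 1 = p ∧ Y 1 = 0)
    {γ : CurvePath Cpl[a, b, c]}
    (hγ : ∀ t, γ.toFun t = ![((xs * √(cr / (X t - br / 3)) : ℝ) : ℂ),
      1 * (Y t : ℂ) * ((xs * √(cr / (X t - br / 3)) : ℝ) : ℂ) ^ 3 / c])
    (hpos : ∀ t ∈ Icc (0 : ℝ) 1, 0 < cr / (X t - br / 3))
    (hP0 : 0 < ∑ j, (pe j : ℝ) * (cr / (p - br / 3)) ^ (j : ℕ)) :
    InSpanRel (Sy[Cpl[a, b, c], smooth ha hb hc hbez, θ[μ, ν, π], hasAlgCoeffs_theta hμ hν hπ, γ]) ∧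
    Pe[Cpl[a, b, c], smooth ha hb hc hbez, θ[μ, ν, π], hasAlgCoeffs_theta hμ hν hπ, γ] = 0 := by
  have hI0 : (0 : ℝ) ∈ Icc (0 : ℝ) 1 := ⟨le_rfl, zero_le_one⟩
  have hI1 : (1 : ℝ) ∈ Icc (0 : ℝ) 1 := ⟨zero_le_one, le_rfl⟩
  obtain ⟨γ', hγ'⟩ := exists_pellPath he hd hunit γ
  -- the unit along the lift is real
  have hco : ∀ t ∈ Icc (0 : ℝ) 1, γ'.toFun t 0 =
      ((∑ j, (pe j : ℝ) * (cr / (X t - br / 3)) ^ (j : ℕ) +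
        Y t * (∑ j, (qo j : ℝ) * (cr / (X t - br / 3)) ^ (j : ℕ)) *
          (cr / (X t - br / 3)) ^ 2 / cr : ℝ) : ℂ) := fun t ht => by
    rw [hγ', Matrix.cons_val_zero, pell_lift_coord hPe hQo hcr hxs (hpos t ht).le 1 (hγ t)]
    push_cast
    ring
  have hr : ∀ t ∈ Icc (0 : ℝ) 1, γ'.toFun t 0 = (((γ'.toFun t 0).re : ℝ) : ℂ) :=
    fun t ht => by rw [hco t ht, ofReal_re]
  have hne : ∀ t ∈ Icc (0 : ℝ) 1, (γ'.toFun t 0).re ≠ 0 := fun t ht h => by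
    have hm := (mem_points_mulGroup_iff _).1 (γ'.mem_points t ht)
    rw [hr t ht] at hm
    simp only [h, ofReal_zero, zero_mul] at hm
    exact zero_ne_one hm
  have hr0 : 0 < (γ'.toFun 0 0).re := by
    rw [hco 0 hI0, h0.1, h0.2, ofReal_re]
    simpa using hP0
  have hcont : ContinuousOn (fun s => (γ'.toFun s 0).re) (Icc 0 1) :=
    Complex.continuous_re.comp_continuousOn (contDiffOn_pi.1 γ'.contDiffOn 0).continuousOn
  have hposr : ∀ t ∈ Icc (0 : ℝ) 1, 0 < (γ'.toFun t 0).re := fun t ht => by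
    by_contra hle
    push Not at hle
    obtain ⟨s, hs, hs0⟩ := intermediate_value_Icc' ht.1
      (hcont.mono (Icc_subset_Icc_right ht.2)) ⟨hle, hr0.le⟩
    exact hne s ⟨hs.1, hs.2.trans ht.2⟩ hs0
  have hcl : (γ'.toFun 0 0).re = (γ'.toFun 1 0).re := by
    rw [hco 0 hI0, hco 1 hI1, h0.1, h0.2, h1.1, h1.2]
  have hsp := span_logSym_realPos_closed γ' (r := fun s => (γ'.toFun s 0).re) hr hposr hcl
  have hpe := period_logSym_realPos_closed γ' (r := fun s => (γ'.toFun s 0).re) hr hposr hcl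
  refine ⟨?_, ?_⟩
  · obtain ⟨k, R, w, hR, hw, hsum⟩ := span_add
      (span_pell ha hb hc hμ hν hbez he hd hπ hunit hunitD hp (fun t _ => hγ' t)) hsp
    exact ⟨k, R, w, hR, hw, by rw [← hsum, sub_add_cancel]⟩
  · rw [relation_pell ha hb hc hμ hν hbez he hd hπ hunit hunitD hp (fun t _ => hγ' t), hpe]

end Summit.KontsevichZagierPeriods.KzOnePeriods.G2SDerivation

end
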